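import Summits.Parity.GeneralizedHardyLittlewood.Theorems.BeyondDiagonalBeatsQuarter.OffDiagLayers
import HarnessLib

/-!
# Route `PrimeLevelFamEdge`, crux K_B (stmt-Parity-20343), line `diagonal_kernel_split` rev 4, plan Ω,
# step Ω-d3 `OffDiagLayers` (part 2 of 2): FUBINI `offDiag = 2q̂(2π/q)·Σ_r offDiagLayer`, the divisor
# RE-INDEXING `nᵢ = dᵢkᵢ` of each layer, and the explicit `r`-TAIL

Continues `OffDiagLayers.lean` (joint absolute convergence of `offDiagTerm q l m n r` in `((n₁,n₂), r)`):
* §1 Fubini: `offDiag q l m = 2q̂·(2π/q)·Σ_{r≥1} offDiagLayer q l m r` for `q` prime, `l, m ≥ 1`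
  (`offDiag_eq_tsum_offDiagLayer`; the `r`-series of every `J_q(a,b)` inside `offDiag` converges absolutely by
  Weil — `summable_norm_petKloostermanTerm_all` — so finite sums, constants and the two `Σ'` commute);
* §2 re-indexing: `offDiagLayer q l m r = Σ_{d₁∣l} Σ_{d₂∣m} Σ_{(k₁,k₂)} w_q(d₁k₁,d₂k₂)·r⁻¹S((l/d₁)k₁,(m/d₂)k₂;qr)·
  J₁(4π√((l/d₁)(m/d₂)k₁k₂)/(qr))` (`offDiagLayer_eq_sum_divisors`): `Σ_n Σ_{d∣(l,n)} = Σ_{d∣l} Σ_k` with `n = dk`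
  and `l·dk/d² = (l/d)k` — each inner series is a plain sum over `ℕ × ℕ` against ONE Kloosterman sum to modulus
  `qr`, the shape Ω-d1 (twisted Poisson mod `qr`) consumes;
* §3 the `r`-tail: `offDiag = 2q̂(2π/q)·(Σ_{1≤r≤R} offDiagLayer + Σ_{k≥0} offDiagLayer (k+R+1))` for every `R`
  (`offDiag_eq_head_add_tail`), `‖offDiagLayer r‖ ≤ 4πC q^{−1/2} r^{−29/20}·offDiagSize q l m`
  (`norm_offDiagLayer_le`), `‖Σ_{k≥0} offDiagLayer (k+R+1)‖ ≤ A·q^{−1/2}(R+1)^{−2/5}·offDiagSize q l m`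
  (`exists_norm_offDiagTail_le`), where `offDiagSize q l m = Σ_n w_q(n)·offDiagPairSize l m n ≤ B·τ(l)τ(m)(lm)^{3/4}q̂³`
  (`exists_offDiagSize_le`) — all constants absolute.
Identities and absolute-value bounds at a FIXED prime level: no cancellation is used, no asymptotic is claimed,
nothing about the heart. Helper (`--supports stmt-Parity-20343`); standard axioms.
«The programme SEARCHES and TYPES; no claim about Landau–Siegel zeros, Theorems 1–2 of arXiv:2211.02515 or
a repaired Margin232 until a kernel theorem says so.»
-/

noncomputable section

open Finset
open scoped Real

namespace Summit.Parity.GeneralizedHardyLittlewood.Theorems.BeyondDiagonalBeatsQuarter.PeterssonSplit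

open Literature.NumberTheory.LFunctions Literature.NumberTheory.LFunctions.KMV2000
open Literature.NumberTheory.LFunctions.KowalskiMichel2000 (petKloostermanTerm petJ petJ_def
  petKloostermanTerm_zero summable_norm_petKloostermanTerm_all)
open Summit.Parity.GeneralizedHardyLittlewood.Theorems.PrimeLevelFamEdgeIdeaDeltas.PeterssonLayers
  (tsum_shift_rpow_le summable_prod_rpow one_le_mul_div_sq)

variable {q : ℕ} [NeZero q]

/-! ### §1. Fubini: the off-diagonal is the sum of its layers -/

/-- Per AFE index: `w_q(n)·Σ_{d₁,d₂} J_q(a,b) = (2π/q)·Σ_r offDiagTerm q l m n r` (`q` prime, `l ≥ 1`;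
the `r`-series of each `J_q(a,b)`, `a ≥ 1`, converges absolutely by Weil — `summable_norm_petKloostermanTerm_all`).
[cite: KowalskiMichel2000, §2.4.2 p. 312 (definition of J, (23))] -/
theorem afeWeight_mul_sum_petJ (hq : q.Prime) {l : ℕ} (hl : 1 ≤ l) (m : ℕ) (n : ℕ × ℕ) :
    (afeWeight q n : ℂ) * ∑ d₁ ∈ (l.gcd n.1).divisors, ∑ d₂ ∈ (m.gcd n.2).divisors,
        petJ q (l * n.1 / d₁ ^ 2) (m * n.2 / d₂ ^ 2) =
      2 * π / q * ∑' r : ℕ, offDiagTerm q l m n r := by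
  by_cases h : n.1 = 0 ∨ n.2 = 0
  · have hw : afeWeight q n = 0 := h.elim afeWeight_eq_zero_of_fst afeWeight_eq_zero_of_snd
    simp [hw, offDiagTerm_eq_zero_of_axes h]
  push Not at h
  have h1 : 1 ≤ n.1 := Nat.one_le_iff_ne_zero.2 h.1
  have hS : ∀ d₁ ∈ (l.gcd n.1).divisors, ∀ d₂ ∈ (m.gcd n.2).divisors,
      Summable (fun r : ℕ ↦ petKloostermanTerm q (l * n.1 / d₁ ^ 2) (m * n.2 / d₂ ^ 2) r) :=
    fun d₁ hd₁ d₂ _ ↦ (summable_norm_petKloostermanTerm_all hq (one_le_mul_div_sq hd₁ hl h1)).of_norm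
  have hA : ∑' r : ℕ, offDiagTerm q l m n r =
      (afeWeight q n : ℂ) * ∑ d₁ ∈ (l.gcd n.1).divisors, ∑ d₂ ∈ (m.gcd n.2).divisors,
        ∑' r : ℕ, petKloostermanTerm q (l * n.1 / d₁ ^ 2) (m * n.2 / d₂ ^ 2) r := by
    unfold offDiagTerm
    rw [tsum_mul_left, Summable.tsum_finsetSum (fun d₁ hd₁ ↦ summable_sum fun d₂ hd₂ ↦ hS d₁ hd₁ d₂ hd₂)]
    congr 1
    exact Finset.sum_congr rfl fun d₁ hd₁ ↦ Summable.tsum_finsetSum fun d₂ hd₂ ↦ hS d₁ hd₁ d₂ hd₂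
  have hB : ∑ d₁ ∈ (l.gcd n.1).divisors, ∑ d₂ ∈ (m.gcd n.2).divisors,
        petJ q (l * n.1 / d₁ ^ 2) (m * n.2 / d₂ ^ 2) =
      2 * π / q * ∑ d₁ ∈ (l.gcd n.1).divisors, ∑ d₂ ∈ (m.gcd n.2).divisors,
        ∑' r : ℕ, petKloostermanTerm q (l * n.1 / d₁ ^ 2) (m * n.2 / d₂ ^ 2) r := by
    rw [Finset.mul_sum]
    refine Finset.sum_congr rfl fun d₁ _ ↦ ?_
    rw [Finset.mul_sum]
    exact Finset.sum_congr rfl fun d₂ _ ↦ petJ_def q _ _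
  rw [hB, hA]
  ring

/-- **Ω-d3, Fubini: the off-diagonal is the absolutely convergent sum of its Petersson layers.** For `q` prime
and `l, m ≥ 1`: `offDiag q l m = 2q̂·(2π/q)·Σ_{r} offDiagLayer q l m r` (the `r = 0` layer is `0`).
[cite: KowalskiMichelVanderKam2000, (21)–(23) p. 12 and Lemma 3.3 p. 9; KowalskiMichel2000, §2.4.2 p. 312 — derivation] -/
theorem offDiag_eq_tsum_offDiagLayer (hq : q.Prime) {l m : ℕ} (hl : 1 ≤ l) (hm : 1 ≤ m) :
    offDiag q l m = 2 * (qhat q : ℂ) * (2 * π / q) * ∑' r : ℕ, offDiagLayer q l m r := by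
  unfold offDiag offDiagLayer
  rw [tsum_congr (afeWeight_mul_sum_petJ hq hl m), tsum_mul_left,
    ← (summable_offDiagTerm hq hl hm).tsum_comm]
  ring

/-! ### §2. Re-indexing the layers by `nᵢ = dᵢ kᵢ` -/

/-- The layer summand as a sum of indicator pieces over the FIXED index set `{d₁ ∣ l} × {d₂ ∣ m}`
(`(l,n₁)`'s divisors are `l`'s divisors dividing `n₁`). [folklore] -/
theorem offDiagTerm_eq_sum_ite {l m : ℕ} (hl : l ≠ 0) (hm : m ≠ 0) (n : ℕ × ℕ) (r : ℕ) :
    offDiagTerm q l m n r = ∑ p ∈ l.divisors ×ˢ m.divisors,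
      if p.1 ∣ n.1 ∧ p.2 ∣ n.2 then
        (afeWeight q n : ℂ) * petKloostermanTerm q (l * n.1 / p.1 ^ 2) (m * n.2 / p.2 ^ 2) r else 0 := by
  classical
  have hfilter : (l.divisors ×ˢ m.divisors).filter (fun p : ℕ × ℕ ↦ p.1 ∣ n.1 ∧ p.2 ∣ n.2) =
      (l.gcd n.1).divisors ×ˢ (m.gcd n.2).divisors := by
    ext p
    simp only [Finset.mem_filter, Finset.mem_product, divisors_gcd_eq_filter hl, divisors_gcd_eq_filter hm]
    tauto
  rw [← Finset.sum_filter, hfilter, Finset.sum_product]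
  unfold offDiagTerm
  simp only [Finset.mul_sum]

omit [NeZero q] in
/-- **Re-indexing one indicator series**: for `d₁, d₂ ≠ 0` and any `F`,
`Σ_{(n₁,n₂)} 𝟙[d₁∣n₁, d₂∣n₂]·F(n₁,n₂) = Σ_{(k₁,k₂)} F(d₁k₁, d₂k₂)` (a bijection of supports; no convergence
hypothesis). [folklore] -/
theorem tsum_ite_dvd_eq {d₁ d₂ : ℕ} (hd₁ : d₁ ≠ 0) (hd₂ : d₂ ≠ 0) (F : ℕ × ℕ → ℂ) :
    ∑' n : ℕ × ℕ, (if d₁ ∣ n.1 ∧ d₂ ∣ n.2 then F n else 0) = ∑' k : ℕ × ℕ, F (d₁ * k.1, d₂ * k.2) := by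
  classical
  set g : ℕ × ℕ → ℕ × ℕ := fun k ↦ (d₁ * k.1, d₂ * k.2) with hg
  have hg_inj : Function.Injective g := by
    intro s t hst
    simp only [hg, Prod.mk.injEq] at hst
    exact Prod.ext (Nat.eq_of_mul_eq_mul_left (Nat.pos_of_ne_zero hd₁) hst.1)
      (Nat.eq_of_mul_eq_mul_left (Nat.pos_of_ne_zero hd₂) hst.2)
  have hsupp : Function.support (fun n : ℕ × ℕ ↦ if d₁ ∣ n.1 ∧ d₂ ∣ n.2 then F n else 0) ⊆ Set.range g := by
    intro n hn
    rw [Function.mem_support] at hn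
    have hc : d₁ ∣ n.1 ∧ d₂ ∣ n.2 := by
      by_contra hnot
      exact hn (if_neg hnot)
    obtain ⟨k₁, hk₁⟩ := hc.1
    obtain ⟨k₂, hk₂⟩ := hc.2
    exact ⟨(k₁, k₂), Prod.ext hk₁.symm hk₂.symm⟩
  rw [← hg_inj.tsum_eq hsupp]
  refine tsum_congr fun k ↦ ?_
  simp only [hg]
  rw [if_pos ⟨Dvd.intro _ rfl, Dvd.intro _ rfl⟩]

/-- One indicator piece of a layer is absolutely summable in `n` (dominated by the joint majorant).
[cite: KowalskiMichel2000, §2.4.2 p. 312 (23) — derivation] -/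
theorem summable_ite_piece (hq : q.Prime) {l m : ℕ} (hl : 1 ≤ l) (hm : 1 ≤ m) {p : ℕ × ℕ}
    (hp : p ∈ l.divisors ×ˢ m.divisors) (r : ℕ) :
    Summable (fun n : ℕ × ℕ ↦ if p.1 ∣ n.1 ∧ p.2 ∣ n.2 then
      (afeWeight q n : ℂ) * petKloostermanTerm q (l * n.1 / p.1 ^ 2) (m * n.2 / p.2 ^ 2) r else 0) := by
  obtain ⟨C, -, hC⟩ :=
    Literature.NumberTheory.Sieve.exists_card_divisors_le_mul_rpow' (by norm_num : (0 : ℝ) < 1 / 20)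
  have hq1 : 1 ≤ q := hq.one_lt.le
  have hC0 : 0 ≤ C := by
    have h := hC 1
    simp at h
    linarith
  rw [Finset.mem_product] at hp
  have hp1 : p.1 ∣ l := Nat.dvd_of_mem_divisors hp.1
  set K : ℝ := 4 * π * C * (q : ℝ) ^ (-(1 / 2 : ℝ)) * (r : ℝ) ^ (-(29 / 20 : ℝ)) with hK
  have hK0 : 0 ≤ K := by positivity
  set A : ℝ := 12 * qhat q ^ 3 * ((l : ℝ) * m) ^ (3 / 4 : ℝ) * K with hA
  have hs := (summable_prod_rpow (by norm_num : (1 : ℝ) < 5 / 4)).mul_left A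
  refine Summable.of_norm_bounded hs fun n ↦ ?_
  have hQ : 0 < qhat q := qhat_pos hq1
  have hA0 : 0 ≤ A := by rw [hA]; exact mul_nonneg (by positivity) hK0
  have hRHS : 0 ≤ A * ((n.1 : ℝ) ^ (-(5 / 4 : ℝ)) * (n.2 : ℝ) ^ (-(5 / 4 : ℝ))) :=
    mul_nonneg hA0 (by positivity)
  split_ifs with hc
  · rcases Nat.eq_zero_or_pos n.1 with h1 | h1
    · rw [afeWeight_eq_zero_of_fst h1]; simpa using hRHS
    rcases Nat.eq_zero_or_pos n.2 with h2 | h2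
    · rw [afeWeight_eq_zero_of_snd h2]; simpa using hRHS
    have hd₁ : p.1 ∈ (l.gcd n.1).divisors :=
      Nat.mem_divisors.2 ⟨Nat.dvd_gcd hp1 hc.1, Nat.gcd_ne_zero_left (by omega)⟩
    have hd₂ : p.2 ∈ (m.gcd n.2).divisors :=
      Nat.mem_divisors.2 ⟨Nat.dvd_gcd (Nat.dvd_of_mem_divisors hp.2) hc.2, Nat.gcd_ne_zero_left (by omega)⟩
    have hsplit : (((l : ℝ) * m) * ((n.1 : ℝ) * n.2)) ^ (3 / 4 : ℝ) =
        ((l : ℝ) * m) ^ (3 / 4 : ℝ) * ((n.1 : ℝ) * n.2) ^ (3 / 4 : ℝ) :=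
      Real.mul_rpow (by positivity) (by positivity)
    calc ‖(afeWeight q n : ℂ) * petKloostermanTerm q (l * n.1 / p.1 ^ 2) (m * n.2 / p.2 ^ 2) r‖
        ≤ afeWeight q n * (Real.sqrt (((l * n.1 / p.1 ^ 2).gcd (m * n.2 / p.2 ^ 2) : ℕ) : ℝ) *
            Real.sqrt (((l * n.1 / p.1 ^ 2 : ℕ) : ℝ) * ((m * n.2 / p.2 ^ 2 : ℕ) : ℝ))) * K :=
          norm_afeWeight_mul_petKloostermanTerm_le hq hl m hC n hd₁ p.2 r
      _ ≤ afeWeight q n * (((l : ℝ) * m) * ((n.1 : ℝ) * n.2)) ^ (3 / 4 : ℝ) * K :=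
          mul_le_mul_of_nonneg_right (mul_le_mul_of_nonneg_left
            (sqrt_gcd_mul_sqrt_le_rpow hl hm h1 h2 hd₁ hd₂) (afeWeight_nonneg q n)) hK0
      _ = ((l : ℝ) * m) ^ (3 / 4 : ℝ) * K * (afeWeight q n * ((n.1 : ℝ) * n.2) ^ (3 / 4 : ℝ)) := by
          rw [hsplit]; ring
      _ ≤ ((l : ℝ) * m) ^ (3 / 4 : ℝ) * K *
            (12 * qhat q ^ 3 * ((n.1 : ℝ) ^ (-(5 / 4 : ℝ)) * (n.2 : ℝ) ^ (-(5 / 4 : ℝ)))) :=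
          mul_le_mul_of_nonneg_left (afeWeight_mul_rpow_le hq1 n) (by positivity)
      _ = A * ((n.1 : ℝ) ^ (-(5 / 4 : ℝ)) * (n.2 : ℝ) ^ (-(5 / 4 : ℝ))) := by rw [hA]; ring
  · simpa using hRHS

/-- **Ω-d3, re-indexing: each layer is a finite sum, over `d₁ ∣ l`, `d₂ ∣ m`, of plain double series against
ONE Kloosterman sum to modulus `q·r`.** For `q` prime, `l, m ≥ 1` and every `r`:
`offDiagLayer q l m r = Σ_{d₁∣l} Σ_{d₂∣m} Σ_{(k₁,k₂)} w_q(d₁k₁, d₂k₂) · r⁻¹ S((l/d₁)k₁, (m/d₂)k₂; qr)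
J₁(4π√((l/d₁)(m/d₂)k₁k₂)/(qr))` (substitute `nᵢ = dᵢkᵢ`; `l·d₁k₁/d₁² = (l/d₁)k₁`).
[cite: KowalskiMichelVanderKam2000, (21)–(23) p. 12–13, Lemma 3.3 p. 9 — derivation] -/
theorem offDiagLayer_eq_sum_divisors (hq : q.Prime) {l m : ℕ} (hl : 1 ≤ l) (hm : 1 ≤ m) (r : ℕ) :
    offDiagLayer q l m r = ∑ d₁ ∈ l.divisors, ∑ d₂ ∈ m.divisors, ∑' k : ℕ × ℕ,
      (afeWeight q (d₁ * k.1, d₂ * k.2) : ℂ) * petKloostermanTerm q (l / d₁ * k.1) (m / d₂ * k.2) r := by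
  have hl0 : l ≠ 0 := by omega
  have hm0 : m ≠ 0 := by omega
  unfold offDiagLayer
  rw [tsum_congr (fun n ↦ offDiagTerm_eq_sum_ite (q := q) hl0 hm0 n r),
    Summable.tsum_finsetSum (fun p hp ↦ summable_ite_piece hq hl hm hp r), Finset.sum_product]
  refine Finset.sum_congr rfl fun d₁ hd₁ ↦ Finset.sum_congr rfl fun d₂ hd₂ ↦ ?_
  have hd₁0 : d₁ ≠ 0 := Nat.pos_of_mem_divisors hd₁ |>.ne'
  have hd₂0 : d₂ ≠ 0 := Nat.pos_of_mem_divisors hd₂ |>.ne'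
  rw [tsum_ite_dvd_eq hd₁0 hd₂0]
  refine tsum_congr fun k ↦ ?_
  rw [mul_mul_div_sq (Nat.dvd_of_mem_divisors hd₁) hd₁0, mul_mul_div_sq (Nat.dvd_of_mem_divisors hd₂) hd₂0]

/-! ### §3. The `r`-tail -/

/-- **The size of the pair `(l, m)` for the `r`-tail**: `offDiagSize q l m := Σ_{(n₁,n₂)} w_q(n₁,n₂)·
offDiagPairSize l m (n₁,n₂)` (a convergent series of non-negative reals, `summable_afeWeight_mul_offDiagPairSize`;
`≤ B·τ(l)τ(m)(lm)^{3/4} q̂³`, `exists_offDiagSize_le`). A bookkeeping abbreviation of this line.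
[cite: KowalskiMichel2000, §2.4.2 p. 312 (23) — derivation] -/
def offDiagSize (q : ℕ) [NeZero q] (l m : ℕ) : ℝ :=
  ∑' n : ℕ × ℕ, afeWeight q n * offDiagPairSize l m n

omit [NeZero q] in
/-- `Σ_n w_q(n)·offDiagPairSize l m n` converges (`q, l, m ≥ 1`).
[cite: KowalskiMichel2000, §2.4.2 p. 312 (23) — derivation] -/
theorem summable_afeWeight_mul_offDiagPairSize (hq : 1 ≤ q) {l m : ℕ} (hl : 1 ≤ l) (hm : 1 ≤ m) :
    Summable (fun n : ℕ × ℕ ↦ afeWeight q n * offDiagPairSize l m n) :=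
  Summable.of_nonneg_of_le (fun n ↦ mul_nonneg (afeWeight_nonneg q n) (offDiagPairSize_nonneg l m n))
    (afeWeight_mul_offDiagPairSize_le hq hl hm)
    ((summable_prod_rpow (by norm_num : (1 : ℝ) < 5 / 4)).mul_left _)

/-- `offDiagSize ≥ 0`. [cite: KowalskiMichel2000, §2.4.2 p. 312 (23) — derivation] -/
theorem offDiagSize_nonneg (l m : ℕ) : 0 ≤ offDiagSize q l m :=
  tsum_nonneg fun n ↦ mul_nonneg (afeWeight_nonneg q n) (offDiagPairSize_nonneg l m n)

/-- **The pair size for the tail is polynomial, uniformly**: there is `B ≥ 0` (namely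
`12·Σ_{(n₁,n₂)} n₁^{−5/4}n₂^{−5/4}`) with `offDiagSize q l m ≤ B·τ(l)τ(m)(lm)^{3/4} q̂³` for all `q, l, m ≥ 1`.
[cite: KowalskiMichel2000, §2.4.2 p. 312 (23); KowalskiMichelVanderKam2000, (22) p. 12 — derivation] -/
theorem exists_offDiagSize_le :
    ∃ B : ℝ, 0 ≤ B ∧ ∀ (q : ℕ) [NeZero q], 1 ≤ q → ∀ l m : ℕ, 1 ≤ l → 1 ≤ m →
      offDiagSize q l m ≤ B * ((l.divisors.card : ℝ) * (m.divisors.card : ℝ)) *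
        ((l : ℝ) * m) ^ (3 / 4 : ℝ) * qhat q ^ 3 := by
  set Z : ℝ := ∑' n : ℕ × ℕ, (n.1 : ℝ) ^ (-(5 / 4 : ℝ)) * (n.2 : ℝ) ^ (-(5 / 4 : ℝ)) with hZ
  have hZ0 : 0 ≤ Z := tsum_nonneg fun n ↦ by positivity
  refine ⟨12 * Z, by positivity, fun q _ hq l m hl hm ↦ ?_⟩
  have hs := summable_prod_rpow (by norm_num : (1 : ℝ) < 5 / 4)
  calc offDiagSize q l m
      ≤ ∑' n : ℕ × ℕ, 12 * qhat q ^ 3 * ((l.divisors.card : ℝ) * (m.divisors.card : ℝ)) *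
          ((l : ℝ) * m) ^ (3 / 4 : ℝ) * ((n.1 : ℝ) ^ (-(5 / 4 : ℝ)) * (n.2 : ℝ) ^ (-(5 / 4 : ℝ))) :=
        Summable.tsum_le_tsum (afeWeight_mul_offDiagPairSize_le hq hl hm)
          (summable_afeWeight_mul_offDiagPairSize hq hl hm) (hs.mul_left _)
    _ = _ := by rw [tsum_mul_left, hZ]; ring

/-- **Each layer is bounded by the pair size**: for `q` prime, `l, m ≥ 1`, a divisor bound `τ(r) ≤ C r^{1/20}`
and every `r`: `‖offDiagLayer q l m r‖ ≤ 4πC q^{−1/2} r^{−29/20} · offDiagSize q l m`.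
[cite: KowalskiMichel2000, §2.4.2 p. 312 (23) — derivation] -/
theorem norm_offDiagLayer_le (hq : q.Prime) {l m : ℕ} (hl : 1 ≤ l) (hm : 1 ≤ m) {C : ℝ}
    (hC : ∀ r : ℕ, ((r.divisors.card : ℕ) : ℝ) ≤ C * (r : ℝ) ^ (1 / 20 : ℝ)) (r : ℕ) :
    ‖offDiagLayer q l m r‖ ≤
      4 * π * C * (q : ℝ) ^ (-(1 / 2 : ℝ)) * (r : ℝ) ^ (-(29 / 20 : ℝ)) * offDiagSize q l m := by
  have hq1 : 1 ≤ q := hq.one_lt.le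
  set K : ℝ := 4 * π * C * (q : ℝ) ^ (-(1 / 2 : ℝ)) * (r : ℝ) ^ (-(29 / 20 : ℝ)) with hK
  have hns : Summable (fun n : ℕ × ℕ ↦ ‖offDiagTerm q l m n r‖) := (summable_offDiagTerm_right hq hl hm r).norm
  have hmaj : Summable (fun n : ℕ × ℕ ↦ afeWeight q n * offDiagPairSize l m n * K) :=
    (summable_afeWeight_mul_offDiagPairSize hq1 hl hm).mul_right K
  unfold offDiagLayer offDiagSize
  calc ‖∑' n : ℕ × ℕ, offDiagTerm q l m n r‖
      ≤ ∑' n : ℕ × ℕ, ‖offDiagTerm q l m n r‖ := norm_tsum_le_tsum_norm hns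
    _ ≤ ∑' n : ℕ × ℕ, afeWeight q n * offDiagPairSize l m n * K :=
        Summable.tsum_le_tsum (fun n ↦ norm_offDiagTerm_le hq hl m hC n r) hns hmaj
    _ = (∑' n : ℕ × ℕ, afeWeight q n * offDiagPairSize l m n) * K := tsum_mul_right
    _ = _ := by rw [hK]; ring

/-- The finite layer sum over `[1, R]` is the one over `range (R+1)` (the zeroth layer vanishes). [folklore] -/
theorem sum_range_offDiagLayer (l m R : ℕ) :
    ∑ r ∈ range (R + 1), offDiagLayer q l m r = ∑ r ∈ Icc 1 R, offDiagLayer q l m r := by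
  rw [Finset.range_eq_Ico, Finset.sum_eq_sum_Ico_succ_bot (by omega), offDiagLayer_zero, zero_add, zero_add,
    Finset.Ico_add_one_right_eq_Icc]

/-- **Ω-d3, the explicit `r`-truncation (identity).** For `q` prime, `l, m ≥ 1` and every `R`:
`offDiag q l m = 2q̂·(2π/q)·( Σ_{1 ≤ r ≤ R} offDiagLayer q l m r + Σ_{k ≥ 0} offDiagLayer q l m (k+R+1) )`.
[cite: KowalskiMichelVanderKam2000, (21)–(23) p. 12 and Lemma 3.3 p. 9; KowalskiMichel2000, §2.4.2 p. 312 — derivation] -/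
theorem offDiag_eq_head_add_tail (hq : q.Prime) {l m : ℕ} (hl : 1 ≤ l) (hm : 1 ≤ m) (R : ℕ) :
    offDiag q l m = 2 * (qhat q : ℂ) * (2 * π / q) *
      (∑ r ∈ Icc 1 R, offDiagLayer q l m r + ∑' k : ℕ, offDiagLayer q l m (k + (R + 1))) := by
  rw [offDiag_eq_tsum_offDiagLayer hq hl hm, ← sum_range_offDiagLayer,
    (summable_offDiagLayer hq hl hm).sum_add_tsum_nat_add (R + 1)]

/-- **Ω-d3, the `r`-tail bound (Weil).** There is `A ≥ 0` (namely `4πC_{1/20}·Σ_k (k+1)^{−21/20}`) such that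
for all primes `q`, all `l, m ≥ 1` and all `R`:
`‖Σ_{k ≥ 0} offDiagLayer q l m (k+R+1)‖ ≤ A · q^{−1/2} · (R+1)^{−2/5} · offDiagSize q l m`.
[cite: KowalskiMichel2000, §2.4.2 p. 312 (23) — derivation] -/
theorem exists_norm_offDiagTail_le :
    ∃ A : ℝ, 0 ≤ A ∧ ∀ (q : ℕ) [NeZero q], q.Prime → ∀ l m R : ℕ, 1 ≤ l → 1 ≤ m →
      ‖∑' k : ℕ, offDiagLayer q l m (k + (R + 1))‖ ≤
        A * (q : ℝ) ^ (-(1 / 2 : ℝ)) * (((R + 1 : ℕ) : ℝ)) ^ (-(2 / 5 : ℝ)) * offDiagSize q l m := by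
  obtain ⟨C, hC1, hC⟩ :=
    Literature.NumberTheory.Sieve.exists_card_divisors_le_mul_rpow' (by norm_num : (0 : ℝ) < 1 / 20)
  have hC0 : 0 ≤ C := zero_le_one.trans hC1
  set Z : ℝ := ∑' k : ℕ, (((k + 1 : ℕ) : ℝ)) ^ (-(21 / 20 : ℝ)) with hZ
  have hZ0 : 0 ≤ Z := tsum_nonneg fun k ↦ Real.rpow_nonneg (Nat.cast_nonneg _) _
  refine ⟨4 * π * C * Z, by positivity, fun q _ hq l m R hl hm ↦ ?_⟩
  obtain ⟨hS, hT⟩ := tsum_shift_rpow_le R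
  set Y : ℝ := 4 * π * C * (q : ℝ) ^ (-(1 / 2 : ℝ)) * offDiagSize q l m with hY
  have hY0 : 0 ≤ Y := by have := offDiagSize_nonneg (q := q) l m; positivity
  have hterm : ∀ k : ℕ, ‖offDiagLayer q l m (k + (R + 1))‖ ≤
      Y * (((k + R + 1 : ℕ) : ℝ)) ^ (-(29 / 20 : ℝ)) := by
    intro k
    have h := norm_offDiagLayer_le hq hl hm hC (k + (R + 1))
    have hcast : (((k + (R + 1) : ℕ) : ℝ)) = (((k + R + 1 : ℕ) : ℝ)) := by push_cast; ring
    rw [hcast] at h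
    calc ‖offDiagLayer q l m (k + (R + 1))‖
        ≤ 4 * π * C * (q : ℝ) ^ (-(1 / 2 : ℝ)) * (((k + R + 1 : ℕ) : ℝ)) ^ (-(29 / 20 : ℝ)) *
            offDiagSize q l m := h
      _ = Y * (((k + R + 1 : ℕ) : ℝ)) ^ (-(29 / 20 : ℝ)) := by rw [hY]; ring
  have hmaj : Summable (fun k : ℕ ↦ Y * (((k + R + 1 : ℕ) : ℝ)) ^ (-(29 / 20 : ℝ))) := hS.mul_left Y
  have hns : Summable (fun k : ℕ ↦ ‖offDiagLayer q l m (k + (R + 1))‖) :=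
    Summable.of_nonneg_of_le (fun _ ↦ norm_nonneg _) hterm hmaj
  calc ‖∑' k : ℕ, offDiagLayer q l m (k + (R + 1))‖
      ≤ ∑' k : ℕ, ‖offDiagLayer q l m (k + (R + 1))‖ := norm_tsum_le_tsum_norm hns
    _ ≤ ∑' k : ℕ, Y * (((k + R + 1 : ℕ) : ℝ)) ^ (-(29 / 20 : ℝ)) := Summable.tsum_le_tsum hterm hns hmaj
    _ = Y * ∑' k : ℕ, (((k + R + 1 : ℕ) : ℝ)) ^ (-(29 / 20 : ℝ)) := tsum_mul_left
    _ ≤ Y * (Z * (((R + 1 : ℕ) : ℝ)) ^ (-(2 / 5 : ℝ))) := mul_le_mul_of_nonneg_left hT hY0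
    _ = _ := by rw [hY]; ring

end Summit.Parity.GeneralizedHardyLittlewood.Theorems.BeyondDiagonalBeatsQuarter.PeterssonSplit
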